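import Summits.ResolutionOfSingularities.ResolutionOfSingularities.Theorems.PurelyInseparableDim4HasseEulerLadder
import HarnessLib

/-!
# Step (α) of the plateau law Π: Hasse derivatives in ONE non-exceptional translated variable
# (cell `res-dim4-pi`, I-5-5; res-dim4-crit-2 V-B-22 add. 2 Step (α); idea-5 consolidated write-up §4)

[OURS · counted 0 · instrument lemma]  Nothing here is a statement about resolution of singularities in
dimension ≥ 4 / characteristic `p`, which is NOT proved.  Pure algebra over the Hasse–Euler bricks
(`…HasseEuler`, `…HasseEulerLadder`):

* `apply_dvd_of_hasseDeriv_single_eq_zero` — **(L2′) injectivity**: in characteristic `p`, if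
  `D^{(p^k e_i)} G = 0` for every `k < e`, then every monomial of `G` has `x_i`-exponent `≡ 0 (mod p^e)`
  (a monomial with `p^e ∤ m_i` is seen by `D^{(p^{v_p(m_i)} e_i)}`: tree `exists_natCast_choose_prime_pow_ne_zero`);
* `hasseDeriv_single_translate_monomial_mul` — for `i ∉ supp r`, the unit factor `E = (x + t)^r` is
  `D_i`-constant: `D^{(ℓ e_i)}(E · W) = E · D^{(ℓ e_i)} W` (higher Leibniz rule `hasseDeriv_mul`);
* **`step_alpha_core`** — for `P := ((x+t)^r · Σ_{β ∈ B} c_β (x+t)^β)` = `translate t (x^r · S)`,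
  `S = Σ_{β∈B} c_β x^β` (`c_β ≠ 0`, `t ≠ 0` on `supp r`, `i ∉ supp r`, `|β| ≤ κ` on `B`): HYPOTHESIS H «every
  monomial of `P` of degree `≤ κ` is a `p^e`-th power» forces `p^e ∣ β_i` for EVERY `β ∈ B`
  (order lemma `le_ordZero_hasseDeriv` ⇒ `ord₀ D_i^{(ℓ)} S(x+t) ≥ κ + 1 − ℓ` ⇒ `D_i^{(ℓ)} S = 0` by (Z)
  ⇒ injectivity at `ℓ = p^k`).  In the Π proof the witness class element has `a_i ≢ 0 (mod q)` —
  contradiction; this is Step (α) for `i ∈ T ∖ Δ`.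

Typed by res-dim4-typ-1.  Supports stmt-ResolutionOfSingularities-16155 (helper).
bears_on: LADDER-RESOLUTION:D157-DOOR2 (res-dim4-pi · I-5-5 Π · Step α core).
-/

set_option linter.dupNamespace false -- mandated namespace of this single-conjunct summit

namespace Summit.ResolutionOfSingularities.ResolutionOfSingularities.Theorems.PIDim4

namespace HasseEuler

open MvPolynomial Finset
open Literature.AlgebraicGeometry.Resolution
open Literature.AlgebraicGeometry.Resolution.Hauser2010

variable {σ : Type*} [DecidableEq σ] {K : Type*} [Field K]

/-! ## §1 (L2′): `D^{(p^k e_i)}`, `k < e`, detect every `x_i`-exponent not divisible by `p^e` -/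

/-- **(L2′) injectivity.** If `D^{(p^k e_i)} G = 0` for all `k < e` (characteristic `p`), then every
monomial of `G` has `x_i`-exponent divisible by `p^e`. [cite: Moh1987, §1 Proposition 1] -/
theorem apply_dvd_of_hasseDeriv_single_eq_zero (p : ℕ) [Fact p.Prime] [CharP K p] {e : ℕ} (i : σ)
    (G : MvPolynomial σ K) (hD : ∀ k, k < e → hasseDeriv K (Finsupp.single i (p ^ k)) G = 0) :
    ∀ m ∈ G.support, p ^ e ∣ m i := by
  intro m hm
  by_contra hnd
  obtain ⟨k, hk, hne⟩ := exists_natCast_choose_prime_pow_ne_zero p K hnd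
  have hle : p ^ k ≤ m i := by
    by_contra hlt
    exact hne (by rw [Nat.choose_eq_zero_of_lt (not_le.mp hlt), Nat.cast_zero])
  -- the coefficient of `x^{m - p^k e_i}` in `D^{(p^k e_i)} G` is `C(m_i, p^k) · coeff_m G ≠ 0`
  have hsum : Finsupp.single i (p ^ k) + (m - Finsupp.single i (p ^ k)) = m :=
    add_tsub_cancel_of_le (Finsupp.single_le_iff.mpr (by simpa using hle))
  have hcoeff := coeff_hasseDeriv (Finsupp.single i (p ^ k)) (m - Finsupp.single i (p ^ k)) G
  rw [hD k hk, coeff_zero, hsum,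
    Finsupp.support_single _ (pow_ne_zero k (Fact.out : p.Prime).ne_zero),
    Finset.prod_singleton, Finsupp.single_eq_same] at hcoeff
  exact mul_ne_zero hne (MvPolynomial.mem_support_iff.mp hm) hcoeff.symm

/-! ## §2 The unit factor is `D_i`-constant -/

/-- A monomial `x^r` with `r_i = 0` is killed by every `D^{(α)}` with `α_i ≠ 0`. [folklore] -/
theorem hasseDeriv_monomial_eq_zero_of_apply (α r : σ →₀ ℕ) {i : σ} (hα : α i ≠ 0) (hr : r i = 0)
    (c : K) : hasseDeriv K α (monomial r c) = 0 := by
  rw [hasseDeriv_monomial]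
  have : (∏ j ∈ α.support, (r j).choose (α j)) = 0 :=
    Finset.prod_eq_zero (Finsupp.mem_support_iff.mpr hα)
      (by rw [hr]; exact Nat.choose_eq_zero_of_lt (Nat.pos_of_ne_zero hα))
  rw [this, Nat.cast_zero, zero_mul]

/-- **`D^{(ℓ e_i)}(E · W) = E · D^{(ℓ e_i)} W`** for the unit factor `E = (x + t)^r` when `x_i` does not
occur in `x^r` (`i ∉ supp r`): by the higher Leibniz rule, every term with a positive derivative on `E`
vanishes. [folklore] -/
theorem hasseDeriv_single_translate_monomial_mul (t : σ → K) (r : σ →₀ ℕ) {i : σ} (hi : r i = 0)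
    (ℓ : ℕ) (W : MvPolynomial σ K) :
    hasseDeriv K (Finsupp.single i ℓ) (PointBlowup.translate t (monomial r (1 : K)) * W) =
      PointBlowup.translate t (monomial r (1 : K)) * hasseDeriv K (Finsupp.single i ℓ) W := by
  rw [hasseDeriv_mul, Finset.sum_eq_single (0, Finsupp.single i ℓ)]
  · rw [hasseDeriv_zero, LinearMap.id_apply]
  · rintro ⟨β, γ⟩ hβγ hne
    simp only [Finset.mem_antidiagonal] at hβγ
    have hβ0 : β ≠ 0 := by
      rintro rfl
      apply hne
      rw [zero_add] at hβγ
      rw [hβγ]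
    -- `β ≤ single i ℓ` and `β ≠ 0` force `β i ≠ 0`
    have hβi : β i ≠ 0 := by
      intro h0
      apply hβ0
      ext j
      have hj := DFunLike.congr_fun hβγ j
      simp only [Finsupp.coe_add, Pi.add_apply, Finsupp.single_apply, Finsupp.coe_zero,
        Pi.zero_apply] at hj ⊢
      by_cases hji : i = j
      · subst hji; exact h0
      · rw [if_neg hji] at hj; omega
    show hasseDeriv K β (PointBlowup.translate t (monomial r (1 : K))) * hasseDeriv K γ W = 0
    rw [hasseDeriv_translate, hasseDeriv_monomial_eq_zero_of_apply β r hβi hi]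
    simp [PointBlowup.translate]
  · intro h
    exact absurd (Finset.mem_antidiagonal.mpr (zero_add _)) h

/-! ## §3 Step (α), algebraic core -/

variable [Fintype σ]

omit [Fintype σ] in
/-- Degrees drop by `ℓ` under `D^{(ℓ e_i)}`: if every monomial of `S` has degree `≤ κ`, every monomial of
`D^{(ℓ e_i)} S` has degree `≤ κ − ℓ`. [folklore] -/
theorem degree_le_of_mem_support_hasseDeriv_single (i : σ) (ℓ κ : ℕ) (S : MvPolynomial σ K)
    (hS : ∀ β ∈ S.support, β.degree ≤ κ) :
    ∀ d ∈ (hasseDeriv K (Finsupp.single i ℓ) S).support, d.degree ≤ κ - ℓ := by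
  intro d hd
  rw [MvPolynomial.mem_support_iff, coeff_hasseDeriv] at hd
  have hmem : Finsupp.single i ℓ + d ∈ S.support := by
    rw [MvPolynomial.mem_support_iff]
    intro h0; exact hd (by rw [h0, mul_zero])
  have := hS _ hmem
  rw [map_add, Finsupp.degree_single] at this
  omega

/-- **STEP (α), algebraic core.**  Let `P := (x^r · Σ_{β ∈ B} c_β x^β)(x + t)` with `c_β ≠ 0`, `t_m ≠ 0`
on `supp r`, `x_i` NOT among the variables of `x^r` (`r_i = 0`: `i ∉ Δ` in the Π proof), and `|β| ≤ κ`
on `B`.  If every monomial of `P` of degree `≤ κ` is a `p^e`-th power (HYPOTHESIS H), then `p^e ∣ β_i` for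
EVERY `β ∈ B`.  In the plateau-law proof `B ∋ a_T − r` with `a_i ≢ 0 (mod q)` — contradiction.
[folklore] -/
theorem step_alpha_core (p : ℕ) [Fact p.Prime] [CharP K p] {e : ℕ} (t : σ → K) (r : σ →₀ ℕ)
    (ht : ∀ m ∈ r.support, t m ≠ 0) {i : σ} (hi : r i = 0) (B : Finset (σ →₀ ℕ))
    (c : (σ →₀ ℕ) → K) (hc : ∀ β ∈ B, c β ≠ 0) (κ : ℕ) (hdeg : ∀ β ∈ B, β.degree ≤ κ)
    (H : ∀ d ∈ (PointBlowup.translate t (monomial r (1 : K) * ∑ β ∈ B, monomial β (c β))).support,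
      d.degree ≤ κ → ∀ j, p ^ e ∣ d j) :
    ∀ β ∈ B, p ^ e ∣ β i := by
  set S : MvPolynomial σ K := ∑ β ∈ B, monomial β (c β) with hS
  -- the support of `S` is `B`
  have hcoeffS : ∀ β, coeff β S = if β ∈ B then c β else 0 := by
    intro β
    rw [hS, coeff_sum]
    simp_rw [coeff_monomial]
    split_ifs with hβ
    · rw [Finset.sum_eq_single β, if_pos rfl]
      · intro β' _ hne; rw [if_neg hne]
      · intro h; exact absurd hβ h
    · refine Finset.sum_eq_zero fun β' hβ' => ?_
      rw [if_neg]
      rintro rfl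
      exact hβ hβ'
  have hsuppS : ∀ β, β ∈ S.support ↔ β ∈ B := by
    intro β
    rw [MvPolynomial.mem_support_iff, hcoeffS]
    constructor
    · intro h; by_contra hβ; exact h (if_neg hβ)
    · intro hβ; rw [if_pos hβ]; exact hc β hβ
  have hSdeg : ∀ β ∈ S.support, β.degree ≤ κ := fun β hβ => hdeg β ((hsuppS β).mp hβ)
  -- `D^{(p^k e_i)} S = 0` for every `k < e`
  have hD : ∀ k, k < e → hasseDeriv K (Finsupp.single i (p ^ k)) S = 0 := by
    intro k hk
    set ℓ := p ^ k with hℓ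
    have hℓ0 : 0 < ℓ := pow_pos (Fact.out : p.Prime).pos k
    have hℓq : ℓ < p ^ e := Nat.pow_lt_pow_right (Fact.out : p.Prime).one_lt hk
    have hα0 : Finsupp.single i ℓ ≠ 0 := Finsupp.single_ne_zero.mpr hℓ0.ne'
    have hαdeg : (Finsupp.single i ℓ).degree < p ^ e := by rw [Finsupp.degree_single]; exact hℓq
    -- order bound for `D_i^{(ℓ)} P = E · (D_i^{(ℓ)} S)(x + t)`
    have key := le_ordZero_hasseDeriv p (κ := κ) hα0 hαdeg
      (PointBlowup.translate t (monomial r (1 : K) * S)) H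
    rw [MohAlong.translate_mul, hasseDeriv_single_translate_monomial_mul t r hi, hasseDeriv_translate,
      ordZero_translate_monomial_mul t r ht, Finsupp.degree_single] at key
    -- degrees of `D_i^{(ℓ)} S` are `≤ κ - ℓ`; with `ord₀ ≥ κ + 1 - ℓ` it vanishes, unless `κ < ℓ`
    by_cases hκ : ℓ ≤ κ
    · have hord : (((κ - ℓ) + 1 : ℕ) : ℕ∞) ≤
          ordZero (PointBlowup.translate t (hasseDeriv K (Finsupp.single i ℓ) S)) := by
        have : κ - ℓ + 1 = κ + 1 - ℓ := by omega
        rw [this]; exact key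
      exact eq_zero_of_degree_le_of_ordZero_translate t _
        (degree_le_of_mem_support_hasseDeriv_single i ℓ κ S hSdeg) hord
    · -- every monomial of `S` has `β_i ≤ |β| ≤ κ < ℓ`: `D^{(ℓ e_i)}` kills it
      rw [hS, map_sum]
      refine Finset.sum_eq_zero fun β hβ => ?_
      rw [hasseDeriv_monomial]
      have hlt : β i < ℓ := lt_of_le_of_lt (le_trans (Finsupp.le_degree i β) (hdeg β hβ)) (not_le.mp hκ)
      have : (∏ j ∈ (Finsupp.single i ℓ).support, (β j).choose ((Finsupp.single i ℓ) j)) = 0 := by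
        rw [Finsupp.support_single _ hℓ0.ne', Finset.prod_singleton, Finsupp.single_eq_same]
        exact Nat.choose_eq_zero_of_lt hlt
      rw [this, Nat.cast_zero, zero_mul]
  intro β hβ
  exact apply_dvd_of_hasseDeriv_single_eq_zero p i S hD β ((hsuppS β).mpr hβ)

end HasseEuler

end Summit.ResolutionOfSingularities.ResolutionOfSingularities.Theorems.PIDim4
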